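import Literature.Analysis.Complex.HalfPlaneDistortion
import Literature.Probability.RandomPlanarGeometry.LoewnerInverseCocycle
import Literature.Probability.RandomPlanarGeometry.SLEDerivativeEstimates
import HarnessLib

/-!
# Joint continuity of the inverse Loewner maps `(t, z) ↦ fₜ(z)` and of `H(y, t) = f̂ₜ(iy)` off the axis

Trunk T-STOCH. For the chordal Loewner chain in `ℍₒ` driven by a continuous `W : ℝ≥0 → ℝ`, with
inverse maps `fₜ = gₜ⁻¹ : ℍₒ → Hₜ` (`Literature.Probability.RandomPlanarGeometry.Loewner.loewnerInv`,
`LoewnerInverse.lean`) and Rohde–Schramm's `f̂ₜ(z) = fₜ(z + W t)`, `H(y, t) = f̂ₜ(iy)`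
(`Loewner.fHat`, `Loewner.tipApproach`, `SLEDerivativeEstimates.lean`), we prove the statement
"`H` is clearly continuous in `(0, ∞) × [0, ∞)`" of the proof of Rohde–Schramm's Theorem 3.6
(*Basic properties of SLE*, Ann. Math. 161 (2005), p. 898; Lawler, *Conformally Invariant
Processes in the Plane* (2005), Remark 4.30: "`V` is clearly continuous on `(0, ∞) × [0, ∞)`"),
quantitatively (`fₜ` is holomorphic and injective on `ℍₒ` with values in `ℍₒ`:
`LoewnerFlow.differentiableOn_invFunOn_map`, `bijOn_invFunOn_map`, `Loewner.im_loewnerInv_pos`):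

* `Loewner.norm_loewnerInv_sub_le` — a **uniform local Lipschitz bound**
  `|fₜ(w) - fₜ(z)| ≤ 8 ((im z + 2t/im z)/im z) |w - z|` for `|w - z| ≤ im z / 2` (Koebe's growth
  bound in the half-plane, `Literature.Analysis.Complex.AreaThm.norm_sub_le_four_mul`, the
  Schwarz–Pick bound `|fₜ'(z)| ≤ 2 im fₜ(z) / im z` for the self-map `fₜ` of `ℍₒ`,
  `…norm_deriv_le_two_mul_im_div`, and `im fₜ(z) ≤ im z + 2t / im z` from the displacement bound
  `|fₜ(z) - z| ≤ 2t / im z`, `Loewner.norm_loewnerInv_sub_self_le'`);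
* `Loewner.norm_loewnerInv_add_sub_le` — the **two-time bound**
  `|f_{t+r}(z) - fₜ(z)| ≤ 8 ((im z + 2t/im z)/im z) (2r / im z)` for `2r / im z ≤ im z / 2` (the
  inverse cocycle `f_{t+r} = fₜ ∘ f^{W(t+·)}_r`, `Loewner.loewnerInv_add`, and the displacement of
  `f^{W(t+·)}_r`);
* `Loewner.continuousAt_loewnerInv_uncurry` — `(t, z) ↦ fₜ(z)` is jointly continuous on
  `[0, ∞) × ℍₒ`, and `Loewner.continuousAt_tipApproach` — `H` is continuous at every `(y, t)`
  with `y ≠ 0`.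

## References

* S. Rohde, O. Schramm, *Basic properties of SLE*, Ann. of Math. 161 (2005), proof of Thm. 3.6
  (p. 898).
* G. F. Lawler, *Conformally Invariant Processes in the Plane*, AMS (2005), Rem. 4.30, proof of
  Lemma 4.33 (eq. (4.12): `|f̂ₜ(i2^{-j}) - f̂_{t+s}(i2^{-j})| ≤ 2 s 2ʲ sup |f'|`).
* Ch. Pommerenke, *Boundary Behaviour of Conformal Maps* (1992), Thm. 1.3 (Koebe distortion).
-/

noncomputable section

open Set Filter Topology Metric Complex
open UpperHalfPlane (upperHalfPlaneSet isOpen_upperHalfPlaneSet)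
open scoped NNReal

namespace Literature.Probability.RandomPlanarGeometry

namespace Loewner

variable {W : ℝ≥0 → ℝ} {z w : ℂ}

/-! ### Quantitative bounds for `fₜ` on `ℍₒ` -/

/-- **Height bound**: `im fₜ(z) ≤ im z + 2t / im z` (from the displacement bound
`|fₜ(z) - z| ≤ 2t / im z`). [folklore] -/
theorem im_loewnerInv_le (hW : Continuous W) (t : ℝ≥0) (hz : 0 < z.im) :
    (loewnerInv W t z).im ≤ z.im + 2 * t / z.im := by
  have h := norm_loewnerInv_sub_self_le' hW t hz
  have h2 : (loewnerInv W t z - z).im ≤ ‖loewnerInv W t z - z‖ :=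
    (le_abs_self _).trans (Complex.abs_im_le_norm _)
  rw [Complex.sub_im] at h2
  linarith

/-- **Schwarz–Pick bound for `fₜ`**: `|fₜ'(z)| ≤ 2 (im z + 2t/im z) / im z` on `ℍₒ` (the bound
`|f'(z)| ≤ 2 im f(z) / im z` for holomorphic self-maps of `ℍₒ`,
`Literature.Analysis.Complex.AreaThm.norm_deriv_le_two_mul_im_div`, and `im_loewnerInv_le`).
[folklore] -/
theorem norm_deriv_loewnerInv_le (hW : Continuous W) (t : ℝ≥0) (hz : 0 < z.im) :
    ‖deriv (loewnerInv W t) z‖ ≤ 2 * (z.im + 2 * t / z.im) / z.im := by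
  have h := Literature.Analysis.Complex.AreaThm.norm_deriv_le_two_mul_im_div
    (differentiableOn_invFunOn_map hW t) (fun _ hw ↦ im_loewnerInv_pos hW t hw) hz
  refine h.trans ?_
  have := im_loewnerInv_le hW t hz
  gcongr

/-- **Uniform local Lipschitz bound for the inverse Loewner maps**: for `z ∈ ℍₒ` and
`|w - z| ≤ im z / 2`, `|fₜ(w) - fₜ(z)| ≤ 8 ((im z + 2t/im z)/im z) |w - z|` (Koebe's growth bound
`|f(w) - f(z)| ≤ 4 |f'(z)| |w - z|` in the half-plane,
`Literature.Analysis.Complex.AreaThm.norm_sub_le_four_mul`, and `norm_deriv_loewnerInv_le`). The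
constant depends on `t` and `im z` only, which is the equicontinuity of `{fₛ : s ≤ t}` near `z`
behind "`H` is clearly continuous in `(0, ∞) × [0, t)`" (Rohde–Schramm (2005), p. 898).
[cite: PommerenkeBBCM1992, Thm. 1.3] -/
theorem norm_loewnerInv_sub_le (hW : Continuous W) (t : ℝ≥0) (hz : 0 < z.im)
    (hw : ‖w - z‖ ≤ z.im / 2) :
    ‖loewnerInv W t w - loewnerInv W t z‖ ≤ 8 * ((z.im + 2 * t / z.im) / z.im) * ‖w - z‖ := by
  have h := Literature.Analysis.Complex.AreaThm.norm_sub_le_four_mul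
    (differentiableOn_invFunOn_map hW t) (bijOn_invFunOn_map hW t).injOn hz hw
  refine h.trans ?_
  have hd := norm_deriv_loewnerInv_le hW t hz
  have hwz : 0 ≤ ‖w - z‖ := norm_nonneg _
  calc 4 * ‖deriv (loewnerInv W t) z‖ * ‖w - z‖
      ≤ 4 * (2 * (z.im + 2 * t / z.im) / z.im) * ‖w - z‖ := by gcongr
    _ = 8 * ((z.im + 2 * t / z.im) / z.im) * ‖w - z‖ := by ring

/-- The Lipschitz constant `8 (im z + 2t/im z)/im z` is nonnegative. [folklore] -/
theorem lipConst_nonneg (t : ℝ≥0) (hz : 0 < z.im) : 0 ≤ 8 * ((z.im + 2 * t / z.im) / z.im) := by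
  positivity

/-- The Lipschitz constant is monotone in `t`. [folklore] -/
theorem lipConst_mono {s t : ℝ} (hst : s ≤ t) (hz : 0 < z.im) :
    8 * ((z.im + 2 * s / z.im) / z.im) ≤ 8 * ((z.im + 2 * t / z.im) / z.im) := by
  gcongr

/-- **Two-time bound**: `|f_{t+r}(z) - fₜ(z)| ≤ 8 ((im z + 2t/im z)/im z) · (2r / im z)` for
`z ∈ ℍₒ` and `2r / im z ≤ im z / 2`: by the inverse cocycle `f_{t+r}(z) = fₜ(w)` with
`w = f^{W(t+·)}_r(z)`, `|w - z| ≤ 2r / im z` (`loewnerInv_add`, `norm_loewnerInv_sub_self_le'`), and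
the uniform local Lipschitz bound for `fₜ`. This is the estimate
"`|f̂ₜ(i2^{-j}) - f̂_{t+s}(i2^{-j})| ≤ 2 s 2ʲ sup_{t ≤ r ≤ t+s} |f'_r|`" of Lawler (2005), proof of
Lemma 4.33, in cocycle form (Rohde–Schramm (2005), (3.23)). [cite: Lawler2005, Lemma 4.33] -/
theorem norm_loewnerInv_add_sub_le (hW : Continuous W) (t r : ℝ≥0) (hz : 0 < z.im)
    (hr : 2 * (r : ℝ) / z.im ≤ z.im / 2) :
    ‖loewnerInv W (t + r) z - loewnerInv W t z‖ ≤
      8 * ((z.im + 2 * t / z.im) / z.im) * (2 * r / z.im) := by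
  rw [loewnerInv_add hW t r hz]
  set w := loewnerInv (fun u ↦ W (t + u)) r z with hw
  have hdisp : ‖w - z‖ ≤ 2 * r / z.im := norm_loewnerInv_sub_self_le' (continuous_shift W hW t) r hz
  calc ‖loewnerInv W t w - loewnerInv W t z‖
      ≤ 8 * ((z.im + 2 * t / z.im) / z.im) * ‖w - z‖ :=
        norm_loewnerInv_sub_le hW t hz (hdisp.trans hr)
    _ ≤ 8 * ((z.im + 2 * t / z.im) / z.im) * (2 * r / z.im) := by
        gcongr

/-! ### Joint continuity -/

/-- **`(t, z) ↦ fₜ(z)` is jointly continuous on `[0, ∞) × ℍₒ`.** Near `(t₀, z₀)`: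
`|fₜ(z) - f_{t₀}(z₀)| ≤ |fₜ(z) - fₜ(z₀)| + |fₜ(z₀) - f_{t₀}(z₀)| ≤ K (|z - z₀| + 2|t - t₀|/im z₀)`
with `K = 8 (im z₀ + 2(t₀+1)/im z₀)/im z₀`, by the uniform local Lipschitz bound and the two-time
bound (applied at the earlier of the two times). Rohde–Schramm (2005), proof of Thm. 3.6, p. 898
("`H` is clearly continuous in `(0, ∞) × [0, t)`"); Lawler (2005), Rem. 4.30.
[cite: RohdeSchramm2005, Thm 3.6 (proof, p. 898)] -/
theorem continuousAt_loewnerInv_uncurry (hW : Continuous W) (t₀ : ℝ≥0) {z₀ : ℂ} (hz₀ : 0 < z₀.im) :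
    ContinuousAt (fun p : ℝ≥0 × ℂ ↦ loewnerInv W p.1 p.2) (t₀, z₀) := by
  set y₀ := z₀.im with hy₀
  set K : ℝ := 8 * ((y₀ + 2 * ((t₀ : ℝ) + 1) / y₀) / y₀) with hK
  have hK0 : 0 ≤ K := by positivity
  -- the neighbourhood on which the estimate holds
  set δ₀ : ℝ := min 1 (y₀ ^ 2 / 4) with hδ₀
  have hδ₀pos : 0 < δ₀ := lt_min one_pos (by positivity)
  have hS : {p : ℝ≥0 × ℂ | dist p.1 t₀ < δ₀ ∧ ‖p.2 - z₀‖ < y₀ / 2} ∈ 𝓝 (t₀, z₀) := by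
    have h1 : {p : ℝ≥0 × ℂ | dist p.1 t₀ < δ₀} ∈ 𝓝 (t₀, z₀) := by
      have : IsOpen {p : ℝ≥0 × ℂ | dist p.1 t₀ < δ₀} :=
        isOpen_lt (continuous_fst.dist continuous_const) continuous_const
      exact this.mem_nhds (by simpa using hδ₀pos)
    have h2 : {p : ℝ≥0 × ℂ | ‖p.2 - z₀‖ < y₀ / 2} ∈ 𝓝 (t₀, z₀) := by
      have : IsOpen {p : ℝ≥0 × ℂ | ‖p.2 - z₀‖ < y₀ / 2} :=
        isOpen_lt (continuous_snd.sub continuous_const).norm continuous_const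
      exact this.mem_nhds (by simpa using half_pos hz₀)
    exact inter_mem h1 h2
  -- the estimate
  have hest : ∀ p : ℝ≥0 × ℂ, dist p.1 t₀ < δ₀ → ‖p.2 - z₀‖ < y₀ / 2 →
      ‖loewnerInv W p.1 p.2 - loewnerInv W t₀ z₀‖ ≤ K * (‖p.2 - z₀‖ + 2 * dist p.1 t₀ / y₀) := by
    rintro ⟨t, z⟩ hdt hdz
    simp only at hdt hdz ⊢
    have ht1 : (t : ℝ) ≤ t₀ + 1 := by
      have h := hdt.trans_le (min_le_left _ _)
      rw [NNReal.dist_eq] at h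
      linarith [le_abs_self ((t : ℝ) - t₀)]
    have hdist_small : 2 * dist t t₀ / y₀ ≤ y₀ / 2 := by
      have h := (hdt.trans_le (min_le_right _ _)).le
      rw [div_le_iff₀ hz₀]
      nlinarith
    -- (i) same time, nearby points
    have h1 : ‖loewnerInv W t z - loewnerInv W t z₀‖ ≤ K * ‖z - z₀‖ := by
      refine (norm_loewnerInv_sub_le hW t hz₀ hdz.le).trans ?_
      exact mul_le_mul_of_nonneg_right (lipConst_mono ht1 hz₀) (norm_nonneg _)
    -- (ii) same point, nearby times
    have h2 : ‖loewnerInv W t z₀ - loewnerInv W t₀ z₀‖ ≤ K * (2 * dist t t₀ / y₀) := by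
      rcases le_total t₀ t with h | h
      · -- `t = t₀ + r`
        obtain ⟨r, rfl⟩ : ∃ r, t = t₀ + r := ⟨t - t₀, (add_tsub_cancel_of_le h).symm⟩
        have hr : dist (t₀ + r) t₀ = (r : ℝ) := by
          rw [NNReal.dist_eq]; push_cast; rw [add_sub_cancel_left, abs_of_nonneg r.coe_nonneg]
        rw [hr] at hdist_small ⊢
        refine (norm_loewnerInv_add_sub_le hW t₀ r hz₀ hdist_small).trans ?_
        refine mul_le_mul_of_nonneg_right (lipConst_mono (by linarith) hz₀) (by positivity)
      · -- `t₀ = t + r`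
        obtain ⟨r, hr0⟩ : ∃ r, t₀ = t + r := ⟨t₀ - t, (add_tsub_cancel_of_le h).symm⟩
        have hr : dist t t₀ = (r : ℝ) := by
          rw [NNReal.dist_eq, hr0]; push_cast
          rw [abs_sub_comm, add_sub_cancel_left, abs_of_nonneg r.coe_nonneg]
        rw [hr] at hdist_small ⊢
        rw [norm_sub_rev, hr0]
        refine (norm_loewnerInv_add_sub_le hW t r hz₀ hdist_small).trans ?_
        exact mul_le_mul_of_nonneg_right (lipConst_mono ht1 hz₀) (by positivity)
    calc ‖loewnerInv W t z - loewnerInv W t₀ z₀‖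
        ≤ ‖loewnerInv W t z - loewnerInv W t z₀‖ + ‖loewnerInv W t z₀ - loewnerInv W t₀ z₀‖ :=
          norm_sub_le_norm_sub_add_norm_sub _ _ _
      _ ≤ K * ‖z - z₀‖ + K * (2 * dist t t₀ / y₀) := add_le_add h1 h2
      _ = K * (‖z - z₀‖ + 2 * dist t t₀ / y₀) := by ring
  -- the right-hand side tends to `0`
  have hlim : Tendsto (fun p : ℝ≥0 × ℂ ↦ K * (‖p.2 - z₀‖ + 2 * dist p.1 t₀ / y₀)) (𝓝 (t₀, z₀))
      (𝓝 0) := by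
    have hc : Continuous fun p : ℝ≥0 × ℂ ↦ K * (‖p.2 - z₀‖ + 2 * dist p.1 t₀ / y₀) :=
      continuous_const.mul ((continuous_snd.sub continuous_const).norm.add
        ((continuous_const.mul (continuous_fst.dist continuous_const)).div_const _))
    have := hc.tendsto (t₀, z₀)
    simpa using this
  rw [ContinuousAt, tendsto_iff_norm_sub_tendsto_zero]
  refine squeeze_zero' (Eventually.of_forall fun _ ↦ norm_nonneg _) ?_ hlim
  filter_upwards [hS] with p hp
  exact hest p hp.1 hp.2

/-- **`H(y, t) = f̂ₜ(iy)` is continuous at every point off the axis `y = 0`**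
(`tipApproach W (y, t) = fₜ(W t + iy)` is the composite of the jointly continuous `(t, z) ↦ fₜ(z)`
with the continuous `(y, t) ↦ (t, W t + iy)`, which lands in `ℍₒ` for `y ≠ 0`). Rohde–Schramm
(2005), proof of Thm. 3.6, p. 898; Lawler (2005), Rem. 4.30.
[cite: RohdeSchramm2005, Thm 3.6 (proof, p. 898)] -/
theorem continuousAt_tipApproach (hW : Continuous W) {p : ℝ≥0 × ℝ≥0} (hp : p.1 ≠ 0) :
    ContinuousAt (tipApproach W) p := by
  have hfun : tipApproach W = (fun q : ℝ≥0 × ℂ ↦ loewnerInv W q.1 q.2) ∘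
      fun p : ℝ≥0 × ℝ≥0 ↦ (p.2, (W p.2 : ℂ) + I * ((p.1 : ℝ) : ℂ)) := by
    funext q
    rfl
  rw [hfun]
  have hin : Continuous fun p : ℝ≥0 × ℝ≥0 ↦ (p.2, (W p.2 : ℂ) + I * ((p.1 : ℝ) : ℂ)) := by
    refine continuous_snd.prodMk ?_
    exact ((Complex.continuous_ofReal.comp (hW.comp continuous_snd)).add
      (continuous_const.mul (Complex.continuous_ofReal.comp
        (NNReal.continuous_coe.comp continuous_fst))))
  refine ContinuousAt.comp ?_ hin.continuousAt
  have him : 0 < ((W p.2 : ℂ) + I * ((p.1 : ℝ) : ℂ)).im := by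
    simpa using pos_iff_ne_zero.2 hp
  exact continuousAt_loewnerInv_uncurry hW p.2 him

end Loewner

end Literature.Probability.RandomPlanarGeometry
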